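import Literature.MathematicalPhysics.QuantumLattice.HubbardCorrelatorCertificateAffine
import Literature.MathematicalPhysics.QuantumLattice.HubbardChainTorusLimitState
import Literature.MathematicalPhysics.QuantumLattice.OrbitStateLocalCertificate
import HarnessLib

/-!
# Hubbard model on `(ℤ/Lℤ)^d`: affine-reduced window certificates with an energy constraint bound the
# orbit-averaged correlators of EVERY sector eigenvector, and of DOPED torus-limit ground states of
# the chain

Family `hubbard` (topic `MathematicalPhysics/QuantumLattice`). The tree has the window
("thermodynamic-limit bootstrap") certificate with an energy constraint and the affine symmetry family
`x ↦ εx + v` (`ε = ±1`) of `ℤ^d` in two finite-volume readings: in the TRACIAL sector ground state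
(`re_projState_ge_of_window_certificate_aff_ineq`, `HubbardCorrelatorCertificateAffine`, any filling)
and — passing to infinite volume — only at HALF FILLING, where Lieb's theorem makes the ground state
of every even torus unique (`InfVolFermionState.IsTorusLimitOf.re_expect_ge_of_chain_window_certificate_ineq`).
This file supplies the general-filling edge, in the form that survives ground-state degeneracy
(the `d`-dimensional pure-Hubbard twin of `HubbardNNNHoppingTorusLimitCorrelator`, which does the
same for the `t–t'` model and the `D₄` family):

* `torusAff_mul`, `fockAff_val_mul`, `affineUnitary_closed` — the
  affine maps `y ↦ εy + v` of the torus form a group: `U_{ε,v} U_{ε₀,w₀} = U_{εε₀, εw₀+v}`; the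
  family `(U_{ε,v})_{v ∈ (ℤ/Lℤ)^d, ε ∈ S}` (`S ⊆ {±1}` closed under multiplication) is closed under
  right multiplication by its members (Han 2020 §2: `F[U⁻¹ O U] = F[O]`);
* `hubbardTorus_re_orbitState_ge_of_local_certificate_ineq_aff` — a local certificate with an energy
  constraint, read in the ORBIT STATE `ω̄_ψ = |S|⁻¹ L^{-d} Σ_{v,ε} ⟨U_{ε,v}ᴴ ψ, · U_{ε,v}ᴴ ψ⟩` of any
  unit eigenvector `ψ` of a sector `(2n, S^z = 0)` of `hubbardTorus d L t U` (the tree's generic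
  `re_orbitState_ge_of_local_certificate_ineq`);
* `re_orbitState_ge_of_window_certificate_aff_ineq` (+ `_groundState`) — the WINDOW
  form: ONE identity in `𝔄_{Λ'}` with objective `X`, density terms, energy term
  `κ (u·1 − Γ(incl) E_Φ)` and Han's constraint families with affine labels `εₗ ∈ S` bounds, for every
  `L ≥ 3` with `x ↦ x mod L` injective on `thicken Λ' 1`, every `n`, and every unit eigenvector `ψ` of
  the sector, `c − Σₖ ‖aₖ‖ + (Σ_σ μ_σ)(n/L^d − ν) + κ (u − E/L^d) ≤ Re ω̄_ψ(Γ(ι_{Λ',L}) X)` — uniformly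
  in `L`, for every vector of a degenerate level (Wang et al. 2024 §III; Han 2020 §3);
* `orbitState_affineUnitary_fermionEmbed_toTorusEmb` — the DICTIONARY: `ω̄_ψ(Γ(ι_{Λ'}) X)` is the mean
  over `ε ∈ S` of the translation-averaged expectations `torusAvgExpectAt` in `ψ` of the reflected
  copies `Γ(affEmb ε 0) X ∈ 𝔄_{εΛ'}` of the window observable;
* `InfVolFermionState.IsTorusLimitOf.re_sum_expect_aff_ge_of_chain_window_certificate_ineq` — the
  THERMODYNAMIC LIMIT for the CHAIN at filling `p/q` (`p ≤ 2q`, `U ≥ 0`): for unit ground states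
  `ψ_j` of the sectors `(2n_j, S^z = 0)` of the rings of length `q·m_j` with `2n_j = p·m_j`, `m_j → ∞`,
  every torus limit `ω` of `ψ` obeys, as soon as `hubbardChainEnergyDensityAt t U p q ≤ u`,
  `c − Σₖ ‖aₖ‖ + (Σ_σ μ_σ)(p/(2q) − ν) ≤ |S|⁻¹ Σ_{ε∈S} Re ω_{εΛ'}(Γ(affEmb ε 0) X)`;
  corollaries `…re_expect_ge_of_chain_window_certificate_ineq_filling` (translation-only
  certificates, all `εₗ = 1`: `… ≤ Re ω_{Λ'}(X)` — the shape of the venture's doped-chain correlator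
  rows) and `…_of_invariant` (reflection-symmetric limits), and the non-vacuity theorem
  `exists_isTorusLimitOf_sectorGroundState_chain_filling` (such torus limits exist along
  `L_j = 2q(j+1)`; they are translation invariant and even).

HONEST SCOPE. A certificate using the reflection `ε = −1` does NOT by itself bound `Re ω(X)` for a
single torus limit `ω` of ground VECTORS (reflection defects need not average out inside a degenerate
multiplet); it bounds the `{±1}`-orbit mean above, or `Re ω(X)` for reflection-symmetric limits;
translation-only certificates give `Re ω(X)` directly. Soundness edge of a thermodynamic-limit
correlator table; no claim on the Hubbard ground state itself. Everything is PROVED; no definition,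
no named fact, no instance.

## References
* J. Wang, J. Surace, I. Frérot, B. Legat, M.-O. Renou, V. Magron, A. Acín, *Certifying ground-state
  properties of many-body systems*, Phys. Rev. X 14 (2024) 031006, §III. [cite: WangEtAl2024, §III]
* X. Han, *Quantum many-body bootstrap*, arXiv:2006.06002 (2020), §2 eq. (2)–(3), §3.
  [cite: Han2020Bootstrap, §3]
* O. Bratteli, D. W. Robinson, *Operator Algebras and Quantum Statistical Mechanics II*, 2nd ed.
  (Springer 1997), §6.2.4 (space-group averages, mean values per site); I §4.3.1.
  [cite: BratteliRobinsonII1997, §6.2.4] [cite: BratteliRobinsonI1987, §4.3.1]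
* G. Benfatto, A. Giuliani, V. Mastropietro, Ann. Henri Poincaré 7 (2006) 809, §2.1–2.2 (parity and
  translation symmetries of the Hubbard chain). [cite: BenfattoGiulianiMastropietro2006, §2.1–2.2]
* D. Ruelle, *Statistical Mechanics: Rigorous Results* (1969), §2.2, §3.4. [cite: Ruelle1969, §2.2]
-/

noncomputable section

namespace Literature.MathematicalPhysics.QuantumLattice

open Matrix Finset HubbardWave0 Literature.Probability.LatticeModels
open Literature.MathematicalPhysics.QuantumManyBody.StateRelaxation
open _root_.Filter
open scoped ComplexOrder BigOperators _root_.Topology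

/-- The identity matrix does not depend on the `DecidableEq` instance used to define it (the affine
torus API of `HubbardWindowCertificateAffine` is stated with the order-derived instance, callers may
carry another). [folklore] -/
private theorem matrix_one_eq_one {m : Type*} (i₁ i₂ : DecidableEq m) :
    (letI := i₁; (1 : Matrix m m ℂ)) = (letI := i₂; (1 : Matrix m m ℂ)) := by
  obtain rfl : i₁ = i₂ := Subsingleton.elim _ _
  rfl

/-! ### The affine group of the torus and its Bogoliubov unitaries -/

section AffineGroup

variable {d L : ℕ}

/-- **Composition of affine maps of the torus**: `(y ↦ εy + v) ∘ (y ↦ ε₀y + w₀) = (y ↦ εε₀ y + (εw₀ + v))`.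
[cite: BenfattoGiulianiMastropietro2006, §2.1–2.2] -/
theorem torusAff_mul (ε ε₀ : ℤˣ) (v w₀ : TorusSite d L) :
    torusAff ε v * torusAff ε₀ w₀ = torusAff (ε * ε₀) (torusAff ε v w₀) := by
  refine Equiv.ext fun y => funext fun i => ?_
  rw [Equiv.Perm.mul_apply, torusAff_apply, torusAff_apply, torusAff_apply, torusAff_apply, Units.val_mul,
    Int.cast_mul]
  ring

/-- **An affine image `εΛ + v` of a region fits into the torus of side `L` iff `Λ` does.**
[cite: BenfattoGiulianiMastropietro2006, §2.1–2.2] -/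
theorem injOn_proj_affShiftSet_iff (L : ℕ) (ε : ℤˣ) (v : Site d) (Λ : Finset (Site d)) :
    Set.InjOn (Torus.proj (d := d) L) ↑(affShiftSet ε v Λ) ↔ Set.InjOn (Torus.proj (d := d) L) ↑Λ := by
  constructor
  · intro h x hx y hy hxy
    have hx' : affSite ε v x ∈ (affShiftSet ε v Λ : Set (Site d)) := by
      rw [Finset.mem_coe]; exact affSite_mem_affShiftSet ε v hx
    have hy' : affSite ε v y ∈ (affShiftSet ε v Λ : Set (Site d)) := by
      rw [Finset.mem_coe]; exact affSite_mem_affShiftSet ε v hy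
    have key := h hx' hy' (by rw [Torus.proj_affSite, Torus.proj_affSite, hxy])
    exact affSite_injective ε v key
  · intro h x hx y hy hxy
    rw [Finset.mem_coe, affShiftSet, Finset.mem_map] at hx hy
    obtain ⟨x₀, hx₀, rfl⟩ := hx
    obtain ⟨y₀, hy₀, rfl⟩ := hy
    have hxy' : torusAff ε (Torus.proj L v) (Torus.proj L x₀) = torusAff ε (Torus.proj L v) (Torus.proj L y₀) := by
      have h' := hxy
      simp only [Function.Embedding.coeFn_mk] at h'
      rwa [Torus.proj_affSite, Torus.proj_affSite] at h'
    have hxy₀ : x₀ = y₀ :=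
      h (Finset.mem_coe.2 hx₀) (Finset.mem_coe.2 hy₀) ((torusAff ε (Torus.proj L v)).injective hxy')
    simp only [Function.Embedding.coeFn_mk, hxy₀]

variable [NeZero L]

/-- `U_{ε,v} U_{ε₀,w₀} = U_{εε₀, εw₀+v}` for the Bogoliubov unitaries. [cite: BratteliRobinsonII1997, §5.2.2, Thm. 5.2.5] -/
theorem fockAff_val_mul (ε ε₀ : ℤˣ) (v w₀ : TorusSite d L) :
    (fockAff ε v).val * (fockAff ε₀ w₀).val = (fockAff (ε * ε₀) (torusAff ε v w₀)).val := by
  have h : fockAff (L := L) ε v * fockAff ε₀ w₀ = fockAff (ε * ε₀) (torusAff ε v w₀) := by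
    show fockRelabel _ * fockRelabel _ = fockRelabel _
    rw [← map_mul, ← Orb.mapPerm_apply, ← Orb.mapPerm_apply, ← Orb.mapPerm_apply, ← map_mul,
      ← FermionTorus.ofTorusPerm_apply, ← FermionTorus.ofTorusPerm_apply, ← FermionTorus.ofTorusPerm_apply,
      ← map_mul, torusAff_mul]
  exact congrArg Subtype.val h

/-- `U_{1,v}` is the translation unitary `U_v`. [folklore] -/
private theorem fockAff_one_eq_fockTranslate (v : TorusSite d L) : fockAff (1 : ℤˣ) v = fockTranslate v := by
  show fockRelabel (Orb.mapEquiv (FermionTorus.ofTorusEquiv (torusAff 1 v))) = fockRelabel (Orb.translate v)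
  rw [torusAff_one]
  rfl

/-- `U_{ε,w} = U_w U_{ε,0}` (linear part first, then translate). [folklore] -/
private theorem fockAff_val_eq_translate_mul (ε : ℤˣ) (w : TorusSite d L) :
    (fockAff ε w).val = (fockTranslate w).val * (fockAff ε 0).val := by
  rw [← fockAff_one_eq_fockTranslate, fockAff_val_mul, one_mul]
  congr 2
  funext i
  simp

/-- `U_{ε,w}ᴴ φ = U_{ε,0}ᴴ (U_{−w} φ)`. [folklore] -/
private theorem fockAff_val_conjTranspose_mulVec (ε : ℤˣ) (w : TorusSite d L)
    (φ : Fock (Orb (FermionTorus d L))) :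
    (fockAff ε w).valᴴ *ᵥ φ = (fockAff ε 0).valᴴ *ᵥ ((fockTranslate (-w)).val *ᵥ φ) := by
  rw [fockAff_val_eq_translate_mul, conjTranspose_mul, fockTranslate_val_conjTranspose, mulVec_mulVec]

/-- **Closure of the affine orbit family**: for `S ⊆ {±1}` closed under multiplication and `ε₀ ∈ S`,
right multiplication by `U_{ε₀,w₀}` permutes the family `(U_{ε,v})_{v, ε ∈ S}`. Han 2020 §2
(`F[U⁻¹ O U] = F[O]` for lattice symmetries). [cite: Han2020Bootstrap, §2] -/
theorem affineUnitary_closed {S : Finset ℤˣ} (hmul : ∀ a ∈ S, ∀ b ∈ S, a * b ∈ S)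
    (w₀ : TorusSite d L) {ε₀ : ℤˣ} (hε₀ : ε₀ ∈ S) :
    ∃ σ : (TorusSite d L × ↥S) ≃ (TorusSite d L × ↥S), ∀ g,
      (fun g : TorusSite d L × ↥S => (fockAff (g.2 : ℤˣ) g.1).val) g * (fockAff ε₀ w₀).val =
        (fun g : TorusSite d L × ↥S => (fockAff (g.2 : ℤˣ) g.1).val) (σ g) := by
  let f : TorusSite d L × ↥S → TorusSite d L × ↥S := fun g =>
    (torusAff (g.2 : ℤˣ) g.1 w₀, ⟨(g.2 : ℤˣ) * ε₀, hmul _ g.2.2 _ hε₀⟩)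
  have hf : Function.Injective f := by
    rintro ⟨w, ε, hε⟩ ⟨w', ε', hε'⟩ h
    simp only [f, Prod.mk.injEq, Subtype.mk.injEq] at h
    obtain ⟨h1, h2⟩ := h
    have hεε : ε = ε' := mul_right_cancel h2
    subst hεε
    have hw : w = w' := by
      funext i
      have := congrFun h1 i
      rw [torusAff_apply, torusAff_apply] at this
      exact add_left_cancel this
    subst hw
    rfl
  refine ⟨Equiv.ofBijective f (Finite.injective_iff_bijective.mp hf), fun g => ?_⟩
  rw [Equiv.ofBijective_apply]
  exact fockAff_val_mul _ _ _ _

/-- Closure under translations (`1 ∈ S`). [cite: Han2020Bootstrap, §2] -/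
theorem affineUnitary_closed_translate {S : Finset ℤˣ} (h1 : (1 : ℤˣ) ∈ S)
    (hmul : ∀ a ∈ S, ∀ b ∈ S, a * b ∈ S) (v : TorusSite d L) :
    ∃ σ : (TorusSite d L × ↥S) ≃ (TorusSite d L × ↥S), ∀ g,
      (fun g : TorusSite d L × ↥S => (fockAff (g.2 : ℤˣ) g.1).val) g * (fockTranslate v).val =
        (fun g : TorusSite d L × ↥S => (fockAff (g.2 : ℤˣ) g.1).val) (σ g) := by
  rw [← fockAff_one_eq_fockTranslate]
  exact affineUnitary_closed hmul v h1

end AffineGroup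

/-! ### The finite torus: a local certificate in the orbit state of an eigenvector -/

section Torus

variable {d L : ℕ} [NeZero L]

/-- **Certificate with an energy constraint ⇒ affine-orbit-averaged expectation of a local observable
in EVERY eigenvector of the Hubbard torus `(ℤ/Lℤ)^d`.** As
`hubbardTorusTT'_re_orbitState_ge_of_local_certificate_ineq` with the affine family
`(U_{ε,v})_{v ∈ (ℤ/Lℤ)^d, ε ∈ S}` (`S ∋ 1` closed under multiplication) in place of the space group of
the square lattice: `c − Σₖ ‖aₖ‖ + Σᵢ μᵢ (gᵢ/L^d − νᵢ) + κ (u − E/L^d) ≤ Re ω̄_ψ(X)` (for any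
`DecidableEq` instance on the torus sites in which the identity `1` of the certificate is written).
[cite: WangEtAl2024, §III] -/
theorem hubbardTorus_re_orbitState_ge_of_local_certificate_ineq_aff [DecidableEq (FermionTorus d L)]
    (t U : ℝ) {nh : ℕ}
    {S : Finset ℤˣ} (h1 : (1 : ℤˣ) ∈ S) (hmul : ∀ a ∈ S, ∀ b ∈ S, a * b ∈ S)
    {ψ : Fock (Orb (FermionTorus d L))}
    (hψK : ψ ∈ (szSector (2 * nh) 0 : Submodule ℂ (Fock (Orb (FermionTorus d L)))))
    (hψ1 : star ψ ⬝ᵥ ψ = 1) {E : ℝ} (hHψ : hubbardTorus d L t U *ᵥ ψ = (E : ℂ) • ψ)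
    (X Eloc : Matrix (Finset (Orb (FermionTorus d L))) (Finset (Orb (FermionTorus d L))) ℂ)
    (hE : ∑ v : TorusSite d L, (fockTranslate v).val * Eloc * (fockTranslate v).valᴴ =
      hubbardTorus d L t U) (κ u : ℝ)
    {δ' : Type*} (dens : Finset δ') (μ ν g : δ' → ℝ)
    (D G : δ' → Matrix (Finset (Orb (FermionTorus d L))) (Finset (Orb (FermionTorus d L))) ℂ)
    (hD : ∀ i ∈ dens, ∑ v : TorusSite d L, (fockTranslate v).val * D i * (fockTranslate v).valᴴ = G i)
    (hG : ∀ i ∈ dens, ∀ φ ∈ (szSector (2 * nh) 0 : Submodule ℂ (Fock (Orb (FermionTorus d L)))),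
      G i *ᵥ φ = ((g i : ℝ) : ℂ) • φ)
    {m : Type*} [Fintype m] [DecidableEq m] {Λm : Matrix m m ℂ} (hΛ : Λm.PosSemidef)
    (O : m → Matrix (Finset (Orb (FermionTorus d L))) (Finset (Orb (FermionTorus d L))) ℂ)
    {κ' : Type*} (s : Finset κ')
    (Xc : κ' → Matrix (Finset (Orb (FermionTorus d L))) (Finset (Orb (FermionTorus d L))) ℂ)
    {ι : Type*} (tt : Finset ι) (ε : ι → ℤˣ) (hεS : ∀ l ∈ tt, ε l ∈ S)
    (wv : ι → TorusSite d L)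
    (Y : ι → Matrix (Finset (Orb (FermionTorus d L))) (Finset (Orb (FermionTorus d L))) ℂ)
    {ρ : Type*} (r : Finset ρ)
    (Q Z Z' : ρ → Matrix (Finset (Orb (FermionTorus d L))) (Finset (Orb (FermionTorus d L))) ℂ)
    (q : ρ → ℝ) (hQh : ∀ i ∈ r, (Q i).IsHermitian)
    (hQ : ∀ i ∈ r, ∀ φ ∈ (szSector (2 * nh) 0 : Submodule ℂ (Fock (Orb (FermionTorus d L)))),
      Q i *ᵥ φ = ((q i : ℝ) : ℂ) • φ)
    {γ' : Type*} (u' : Finset γ')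
    (C W : γ' → Matrix (Finset (Orb (FermionTorus d L))) (Finset (Orb (FermionTorus d L))) ℂ)
    (qc : γ' → ℝ) (hCh : ∀ j ∈ u', (C j).IsHermitian)
    (hC : ∀ j ∈ u', ∀ φ ∈ (szSector (2 * nh) 0 : Submodule ℂ (Fock (Orb (FermionTorus d L)))),
      C j *ᵥ φ = ((qc j : ℝ) : ℂ) • φ)
    {δ : Type*} (ah : Finset δ) (dc : δ → ℝ)
    (V : δ → Matrix (Finset (Orb (FermionTorus d L))) (Finset (Orb (FermionTorus d L))) ℂ)
    {κ'' : Type*} (w : Finset κ'') (a : κ'' → ℂ)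
    (M : κ'' → Matrix (Finset (Orb (FermionTorus d L))) (Finset (Orb (FermionTorus d L))) ℂ)
    (hM : ∀ k ∈ w, (M k).IsContraction) {c : ℝ}
    (hcert : X - (c : ℂ) • (1 : Matrix (Finset (Orb (FermionTorus d L))) (Finset (Orb (FermionTorus d L))) ℂ) -
        ∑ i ∈ dens, ((μ i : ℝ) : ℂ) • (D i - ((ν i : ℝ) : ℂ) •
          (1 : Matrix (Finset (Orb (FermionTorus d L))) (Finset (Orb (FermionTorus d L))) ℂ)) -
        ((κ : ℝ) : ℂ) • (((u : ℝ) : ℂ) •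
          (1 : Matrix (Finset (Orb (FermionTorus d L))) (Finset (Orb (FermionTorus d L))) ℂ) - Eloc) =
      gramForm Λm O +
        (∑ k ∈ s, (hubbardTorus d L t U * Xc k - Xc k * hubbardTorus d L t U) +
          ∑ l ∈ tt, ((fockAff (ε l) (wv l)).val * Y l * (fockAff (ε l) (wv l)).valᴴ - Y l) +
          ∑ i ∈ r, (Z i * (Q i - ((q i : ℝ) : ℂ) • 1) + (Q i - ((q i : ℝ) : ℂ) • 1) * Z' i) +
          ∑ j ∈ u', (C j * W j - W j * C j)) +
        (∑ m' ∈ ah, ((dc m' : ℝ) : ℂ) • ((V m')ᴴ - V m') + ∑ k ∈ w, a k • M k)) :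
    c - ∑ k ∈ w, ‖a k‖ + ∑ i ∈ dens, μ i * (g i / (L : ℝ) ^ d - ν i) + κ * (u - E / (L : ℝ) ^ d) ≤
      (orbitState (fun g : TorusSite d L × ↥S => (fockAff (g.2 : ℤˣ) g.1).val) ψ X).re := by
  haveI : Nonempty ↥S := ⟨⟨1, h1⟩⟩
  have hA : (hubbardTorus d L t U).IsHermitian :=
    hubbardTorus_isHermitian (hamiltonian_isHermitian_and_commute_holds _) t U
  have h := re_orbitState_ge_of_local_certificate_ineq hA (szSector (2 * nh) 0) hψK hψ1 hHψ
    (fun g : TorusSite d L × ↥S => (fockAff (g.2 : ℤˣ) g.1).val)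
    (fun g' => fockAff_mul_hubbardTorus _ _ t U)
    (fun g' => (fockAff_conjTranspose_mul_self _ _).trans (matrix_one_eq_one _ _))
    (fun g' φ hφ => fockAff_conjTranspose_mulVec_mem_szSector _ _ hφ)
    (fun v => (fockTranslate v).val) (fun v => affineUnitary_closed_translate h1 hmul v)
    X Eloc hE κ u dens μ ν g D G hD hG hΛ O s Xc tt
    (fun l => (fockAff (ε l) (wv l)).val) Y
    (fun l hl => affineUnitary_closed hmul (wv l) (hεS l hl))
    r Q Z Z' q hQh hQ u' C W qc hCh hC ah dc V w a M hM hcert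
  rw [card_torusSite] at h
  push_cast at h
  exact h

end Torus

/-! ### The window certificate read in the affine orbit state of every eigenvector -/

section Window

variable {d L : ℕ} [NeZero L]

/-- **Window certificate with an energy constraint and affine reductions ⇒ orbit-averaged
expectation of a local observable in EVERY eigenvector of every large Hubbard torus** (every `d`).
Data as in `re_projState_ge_of_window_certificate_aff_ineq` (objective `X ∈ 𝔄_{Λ'}`, density terms,
energy term `κ (u·1 − Γ(incl) E_Φ)`, SOS + `[H_{Λ'}, B]` + affine defects with labels `εₗ ∈ S` +
charged words + anti-Hermitian parts + residual words). Then for every `L ≥ 3` with `x ↦ x mod L`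
injective on `thicken Λ' 1`, every `n`, every finite `S ∋ 1` closed under multiplication, and every
unit `ψ ∈ szSector (2n) 0` with `hubbardTorus d L t U ψ = E ψ`:
`c − Σₖ ‖aₖ‖ + (Σ_σ μ_σ)(n/L^d − ν) + κ (u − E/L^d) ≤ Re ω̄_ψ(Γ(ι_{Λ',L}) X)`,
`ω̄_ψ` the orbit state over `(U_{ε,v})_{v, ε ∈ S}`. Wang et al. 2024 §III in Han's
translation-invariant form, read in the symmetrised state of an arbitrary eigenvector.
[cite: WangEtAl2024, §III] -/
theorem re_orbitState_ge_of_window_certificate_aff_ineq (t U : ℝ) (hL : 3 ≤ L) {nh : ℕ}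
    {Λ Λ' : Finset (Site d)} (hΛ : Λ ⊆ Λ')
    (hclosed : ∀ x ∈ Λ, ∀ i : Fin d, x + unitVec i ∈ Λ' ∧ x - unitVec i ∈ Λ')
    (h0 : thicken ({0} : Finset (Site d)) 1 ⊆ Λ') (hz : (0 : Site d) ∈ Λ')
    (hInj : Set.InjOn (Torus.proj (d := d) L) ↑(thicken Λ' 1))
    (hInj' : Set.InjOn (Torus.proj (d := d) L) ↑Λ')
    {S : Finset ℤˣ} (h1 : (1 : ℤˣ) ∈ S) (hmul : ∀ a ∈ S, ∀ b ∈ S, a * b ∈ S)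
    {ψ : Fock (Orb (FermionTorus d L))}
    (hψK : ψ ∈ (szSector (2 * nh) 0 : Submodule ℂ (Fock (Orb (FermionTorus d L)))))
    (hψ1 : star ψ ⬝ᵥ ψ = 1) {E : ℝ} (hHψ : hubbardTorus d L t U *ᵥ ψ = (E : ℂ) • ψ)
    (Xw : FermionOp Λ') (κ u : ℝ) (μ : Fin 2 → ℝ) (ν : ℝ)
    {m : Type*} [Fintype m] [DecidableEq m] {Λm : Matrix m m ℂ} (hΛm : Λm.PosSemidef)
    (O : m → FermionOp Λ')
    {κ' : Type*} (s : Finset κ') (B : κ' → FermionOp Λ)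
    {ι : Type*} (tt : Finset ι) (ε : ι → ℤˣ) (hεS : ∀ l ∈ tt, ε l ∈ S) (vv : ι → Site d)
    (hsh : ∀ l, affShiftSet (ε l) (vv l) Λ ⊆ Λ') (Y : ι → FermionOp Λ)
    {ρ : Type*} (uu : Finset ρ) (b : ρ → ℂ) (cw : ρ → List (Orb (PolySite Λ') × Bool))
    (hcw : ∀ j ∈ uu, ladderCharge (cw j) ≠ 0 ∨ ladderSpinCharge (cw j) ≠ 0)
    {δ : Type*} (ah : Finset δ) (dc : δ → ℝ) (V : δ → FermionOp Λ')
    {κ'' : Type*} (w : Finset κ'') (a : κ'' → ℂ) (word : κ'' → List (Orb (PolySite Λ') × Bool)) {c : ℝ}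
    (hcert : Xw - (c : ℂ) • (1 : FermionOp Λ') -
        ∑ σ : Fin 2, ((μ σ : ℝ) : ℂ) • (nAt 0 hz σ - ((ν : ℝ) : ℂ) • (1 : FermionOp Λ')) -
        ((κ : ℝ) : ℂ) • (((u : ℝ) : ℂ) • (1 : FermionOp Λ') -
          fermionEmbed (PolySite.incl h0) ((hubbardFermionInteraction d t U).meanEnergyObs 1)) =
      gramForm Λm O +
        (∑ k ∈ s, ((hubbardFermionInteraction d t U).localHamiltonian Λ' * fermionEmbed (PolySite.incl hΛ) (B k) -
            fermionEmbed (PolySite.incl hΛ) (B k) * (hubbardFermionInteraction d t U).localHamiltonian Λ') +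
          ∑ l ∈ tt, (fermionEmbed (PolySite.incl (hsh l)) (fermionEmbed (PolySite.affEmb (ε l) (vv l) Λ) (Y l)) -
            fermionEmbed (PolySite.incl hΛ) (Y l)) +
          ∑ j ∈ uu, b j • ladderWord (cw j)) +
        (∑ m' ∈ ah, ((dc m' : ℝ) : ℂ) • ((V m')ᴴ - V m') + ∑ k ∈ w, a k • ladderWord (word k))) :
    c - ∑ k ∈ w, ‖a k‖ + (∑ σ : Fin 2, μ σ) * ((nh : ℝ) / (L : ℝ) ^ d - ν) + κ * (u - E / (L : ℝ) ^ d) ≤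
      (orbitState (fun g : TorusSite d L × ↥S => (fockAff (g.2 : ℤˣ) g.1).val) ψ
        (fermionEmbed (PolySite.toTorusEmb L hInj') Xw)).re := by
  -- the affine torus API (`fockAff`, `fermionEmbed_toTorusEmb_aff_sub`, …) is stated with the
  -- order-derived `DecidableEq` of the torus sites; elaborate the torus identities below in it
  letI : DecidableEq (FermionTorus d L) := LinearOrder.toDecidableEq
  have hInjΛ : Set.InjOn (Torus.proj (d := d) L) ↑Λ := hInj'.mono (by exact_mod_cast hΛ)
  have hInj0 : Set.InjOn (Torus.proj (d := d) L) ↑(thicken ({0} : Finset (Site d)) 1) :=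
    hInj'.mono (by exact_mod_cast h0)
  set Γ' := fermionEmbed (PolySite.toTorusEmb L hInj') with hΓ'
  set ΓΛ := fermionEmbed (PolySite.toTorusEmb L hInjΛ) with hΓΛ
  set H := hubbardTorus d L t U with hH
  set EΦ := (hubbardFermionInteraction d t U).meanEnergyObs 1 with hEΦ
  -- the local energy `Γ(ι₀) E_Φ`, whose translates sum to `H`
  set X := Γ' (fermionEmbed (PolySite.incl h0) EΦ) with hX
  have hX0 : X = fermionEmbed (PolySite.toTorusEmb L hInj0) EΦ := fermionEmbed_toTorusEmb_incl h0 hInj' EΦ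
  have hsum : ∑ v' : TorusSite d L, (fockTranslate v').val * X * (fockTranslate v').valᴴ = H := by
    rw [hX0]
    have h := sum_relabel_translate_hubbard_meanEnergyObs (d := d) t U hL
    simp_rw [relabel_eq_fockRelabel_conj] at h
    exact h
  -- density observables
  set D : Fin 2 → Matrix (Finset (Orb (FermionTorus d L))) (Finset (Orb (FermionTorus d L))) ℂ :=
    fun σ => numberOp (FermionTorus.ofTorusSite (0 : TorusSite d L)) σ with hD
  set G : Fin 2 → Matrix (Finset (Orb (FermionTorus d L))) (Finset (Orb (FermionTorus d L))) ℂ :=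
    fun σ => ∑ y : FermionTorus d L, numberOp y σ with hG
  have hDΓ : ∀ σ, Γ' (nAt 0 hz σ) = D σ := fun σ => fermionEmbed_toTorusEmb_nAt_zero hz hInj' σ
  have hDsum : ∀ σ ∈ (Finset.univ : Finset (Fin 2)),
      ∑ v' : TorusSite d L, (fockTranslate v').val * D σ * (fockTranslate v').valᴴ = G σ :=
    fun σ _ => sum_conj_fockTranslate_numberOp 0 σ
  have hGs : ∀ σ ∈ (Finset.univ : Finset (Fin 2)),
      ∀ φ ∈ (szSector (2 * nh) 0 : Submodule ℂ (Fock (Orb (FermionTorus d L)))),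
        G σ *ᵥ φ = (((nh : ℝ) : ℝ) : ℂ) • φ := by
    intro σ _ φ hφ
    rw [hG, spinNumber_mulVec_of_mem_szSector σ hφ]
    congr 1
    push_cast
    ring
  -- symmetry family: affine maps, as torus matrices
  set Yt : ι → Matrix (Finset (Orb (FermionTorus d L))) (Finset (Orb (FermionTorus d L))) ℂ :=
    fun l => ΓΛ (Y l) with hYt
  -- charge family (charged words as commutators with `N̂` / `S^z`, both real scalars on the sector)
  set emb : Orb (PolySite Λ') × Bool → Orb (FermionTorus d L) × Bool :=
    fun p => (Orb.embMap (PolySite.toTorusEmb L hInj') p.1, p.2) with hemb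
  set C : ρ → Matrix (Finset (Orb (FermionTorus d L))) (Finset (Orb (FermionTorus d L))) ℂ :=
    fun j => if ladderCharge ((cw j).map emb) ≠ 0 then totalNumber else HubbardWave0.spinZ with hC
  set W : ρ → Matrix (Finset (Orb (FermionTorus d L))) (Finset (Orb (FermionTorus d L))) ℂ :=
    fun j => (b j / (if ladderCharge ((cw j).map emb) ≠ 0 then ((ladderCharge ((cw j).map emb) : ℤ) : ℂ)
      else ((ladderSpinCharge ((cw j).map emb) : ℤ) : ℂ) / 2)) • ladderWord ((cw j).map emb) with hW
  set qc : ρ → ℝ := fun j => if ladderCharge ((cw j).map emb) ≠ 0 then ((2 * nh : ℕ) : ℝ) else 0 with hqc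
  have hCh : ∀ j ∈ uu, (C j).IsHermitian := by
    intro j _
    by_cases hq : ladderCharge ((cw j).map emb) ≠ 0
    · simp only [hC, hq, ne_eq, not_false_eq_true, if_true]
      show (totalNumber)ᴴ = totalNumber
      rw [totalNumber_eq_numberDiag_univ]
      exact numberDiag_conjTranspose _
    · simp only [hC, hq, if_false]; exact HubbardWave0.spinZ_isHermitian
  have hCq : ∀ j ∈ uu, ∀ φ ∈ (szSector (2 * nh) 0 : Submodule ℂ (Fock (Orb (FermionTorus d L)))),
      C j *ᵥ φ = ((qc j : ℝ) : ℂ) • φ := by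
    intro j _ φ hφ
    obtain ⟨hNφ, hSφ⟩ := (mem_szSector_iff _ _ φ).1 hφ
    by_cases hq : ladderCharge ((cw j).map emb) ≠ 0
    · simp only [hC, hqc, hq, ne_eq, not_false_eq_true, if_true]
      rw [totalNumber_mulVec_of_isNParticle hNφ]
      push_cast
      rfl
    · simp only [hC, hqc, hq, if_false]
      rw [hSφ]
  have hcharged : ∀ j ∈ uu, Γ' (b j • ladderWord (cw j)) = C j * W j - W j * C j := by
    intro j hj
    rw [map_smul, hΓ', fermionEmbed_ladderWord]
    have hl : ladderCharge ((cw j).map emb) ≠ 0 ∨ ladderSpinCharge ((cw j).map emb) ≠ 0 := by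
      rw [hemb, ladderCharge_map_embMap, ladderSpinCharge_map_embMap]; exact hcw j hj
    exact smul_ladderWord_eq_commutator_of_charged (b j) _ hl
  -- residual words
  set M : κ'' → Matrix (Finset (Orb (FermionTorus d L))) (Finset (Orb (FermionTorus d L))) ℂ :=
    fun k => ladderWord ((word k).map emb) with hM
  have hMc : ∀ k ∈ w, (M k).IsContraction := fun k _ => by
    rw [hM]; dsimp only; rw [ladderWord_eq_prod]; exact isContraction_prod_ladder _
  -- the left-hand side, pulled back into the torus
  have hlhs : Γ' (Xw - (c : ℂ) • (1 : FermionOp Λ') -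
        ∑ σ : Fin 2, ((μ σ : ℝ) : ℂ) • (nAt 0 hz σ - ((ν : ℝ) : ℂ) • (1 : FermionOp Λ')) -
        ((κ : ℝ) : ℂ) • (((u : ℝ) : ℂ) • (1 : FermionOp Λ') - fermionEmbed (PolySite.incl h0) EΦ)) =
      Γ' Xw - (c : ℂ) • (1 : Matrix (Finset (Orb (FermionTorus d L))) (Finset (Orb (FermionTorus d L))) ℂ) -
        ∑ σ ∈ (Finset.univ : Finset (Fin 2)), ((μ σ : ℝ) : ℂ) • (D σ - ((ν : ℝ) : ℂ) •
          (1 : Matrix (Finset (Orb (FermionTorus d L))) (Finset (Orb (FermionTorus d L))) ℂ)) -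
        ((κ : ℝ) : ℂ) • (((u : ℝ) : ℂ) •
          (1 : Matrix (Finset (Orb (FermionTorus d L))) (Finset (Orb (FermionTorus d L))) ℂ) - X) := by
    have hs : Γ' (∑ σ : Fin 2, ((μ σ : ℝ) : ℂ) • (nAt 0 hz σ - ((ν : ℝ) : ℂ) • (1 : FermionOp Λ'))) =
        ∑ σ ∈ (Finset.univ : Finset (Fin 2)), ((μ σ : ℝ) : ℂ) • (D σ - ((ν : ℝ) : ℂ) •
          (1 : Matrix (Finset (Orb (FermionTorus d L))) (Finset (Orb (FermionTorus d L))) ℂ)) := by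
      rw [map_sum]
      exact Finset.sum_congr rfl fun σ _ => by rw [map_smul, map_sub, map_smul, map_one, hDΓ]
    have hk : Γ' (((κ : ℝ) : ℂ) • (((u : ℝ) : ℂ) • (1 : FermionOp Λ') - fermionEmbed (PolySite.incl h0) EΦ)) =
        ((κ : ℝ) : ℂ) • (((u : ℝ) : ℂ) •
          (1 : Matrix (Finset (Orb (FermionTorus d L))) (Finset (Orb (FermionTorus d L))) ℂ) - X) := by
      rw [map_smul, map_sub, map_smul, map_one, hX]
    rw [map_sub, hk, map_sub, hs, map_sub, map_smul, map_one]
  -- the identity, pulled back into the torus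
  have htorus : Γ' Xw - (c : ℂ) • (1 : Matrix (Finset (Orb (FermionTorus d L))) (Finset (Orb (FermionTorus d L))) ℂ) -
      ∑ σ ∈ (Finset.univ : Finset (Fin 2)), ((μ σ : ℝ) : ℂ) • (D σ - ((ν : ℝ) : ℂ) •
        (1 : Matrix (Finset (Orb (FermionTorus d L))) (Finset (Orb (FermionTorus d L))) ℂ)) -
      ((κ : ℝ) : ℂ) • (((u : ℝ) : ℂ) •
        (1 : Matrix (Finset (Orb (FermionTorus d L))) (Finset (Orb (FermionTorus d L))) ℂ) - X) =
      gramForm Λm (fun i => Γ' (O i)) +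
        (∑ k ∈ s, (H * Γ' (fermionEmbed (PolySite.incl hΛ) (B k)) - Γ' (fermionEmbed (PolySite.incl hΛ) (B k)) * H) +
          ∑ l ∈ tt, ((fockAff (ε l) (Torus.proj L (vv l))).val * Yt l *
              (fockAff (ε l) (Torus.proj L (vv l))).valᴴ - Yt l) +
          ∑ i ∈ (∅ : Finset (Fin 0)), ((0 : Matrix _ _ ℂ) * ((0 : Matrix _ _ ℂ) - (((0 : ℝ) : ℝ) : ℂ) • 1) +
            ((0 : Matrix _ _ ℂ) - (((0 : ℝ) : ℝ) : ℂ) • 1) * (0 : Matrix _ _ ℂ)) +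
          ∑ j ∈ uu, (C j * W j - W j * C j)) +
        (∑ m' ∈ ah, ((dc m' : ℝ) : ℂ) • ((Γ' (V m'))ᴴ - Γ' (V m')) + ∑ k ∈ w, a k • M k) := by
    have key := congrArg Γ' hcert
    rw [hlhs] at key
    have h1' : Γ' (∑ k ∈ s, ((hubbardFermionInteraction d t U).localHamiltonian Λ' * fermionEmbed (PolySite.incl hΛ) (B k) -
        fermionEmbed (PolySite.incl hΛ) (B k) * (hubbardFermionInteraction d t U).localHamiltonian Λ')) =
        ∑ k ∈ s, (H * Γ' (fermionEmbed (PolySite.incl hΛ) (B k)) - Γ' (fermionEmbed (PolySite.incl hΛ) (B k)) * H) := by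
      rw [map_sum]
      refine Finset.sum_congr rfl fun k _ => ?_
      rw [hH, hΓ', hubbardTorus_commutator_fermionEmbed L t U hΛ hclosed hInj (B k)]
    have h2 : Γ' (∑ l ∈ tt, (fermionEmbed (PolySite.incl (hsh l)) (fermionEmbed (PolySite.affEmb (ε l) (vv l) Λ) (Y l)) -
        fermionEmbed (PolySite.incl hΛ) (Y l))) =
        ∑ l ∈ tt, ((fockAff (ε l) (Torus.proj L (vv l))).val * Yt l *
          (fockAff (ε l) (Torus.proj L (vv l))).valᴴ - Yt l) := by
      rw [map_sum]
      refine Finset.sum_congr rfl fun l _ => ?_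
      rw [hYt, hΓΛ, hΓ']
      exact fermionEmbed_toTorusEmb_aff_sub hΛ (ε l) (vv l) (hsh l) hInj' (Y l)
    have h3 : Γ' (∑ j ∈ uu, b j • ladderWord (cw j)) = ∑ j ∈ uu, (C j * W j - W j * C j) := by
      rw [map_sum]
      exact Finset.sum_congr rfl hcharged
    have h4 : Γ' (∑ m' ∈ ah, ((dc m' : ℝ) : ℂ) • ((V m')ᴴ - V m')) =
        ∑ m' ∈ ah, ((dc m' : ℝ) : ℂ) • ((Γ' (V m'))ᴴ - Γ' (V m')) := by
      rw [map_sum]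
      refine Finset.sum_congr rfl fun m' _ => ?_
      rw [map_smul, map_sub, hΓ', fermionEmbed_conjTranspose]
    have h5 : Γ' (∑ k ∈ w, a k • ladderWord (word k)) = ∑ k ∈ w, a k • M k := by
      rw [map_sum]
      refine Finset.sum_congr rfl fun k _ => ?_
      rw [map_smul, hM, hΓ', fermionEmbed_ladderWord]
    rw [key, map_add, map_add, map_add, map_add, map_add, hΓ', fermionEmbed_gramForm, ← hΓ', h1', h2, h3, h4, h5,
      Finset.sum_empty, add_zero]
  have hmain := hubbardTorus_re_orbitState_ge_of_local_certificate_ineq_aff t U h1 hmul hψK hψ1 hHψ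
    (Γ' Xw) X hsum κ u (Finset.univ : Finset (Fin 2)) μ (fun _ => ν) (fun _ => (nh : ℝ)) D G hDsum hGs hΛm
    (fun i => Γ' (O i)) s (fun k => Γ' (fermionEmbed (PolySite.incl hΛ) (B k))) tt ε hεS
    (fun l => Torus.proj L (vv l)) Yt
    (∅ : Finset (Fin 0)) (fun _ => 0) (fun _ => 0) (fun _ => 0) (fun _ => 0)
    (fun i hi => absurd hi (Finset.notMem_empty i)) (fun i hi => absurd hi (Finset.notMem_empty i))
    uu C W qc hCh hCq ah dc (fun m' => Γ' (V m')) w a M hMc htorus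
  have hs : ∑ σ ∈ (Finset.univ : Finset (Fin 2)), μ σ * ((nh : ℝ) / (L : ℝ) ^ d - ν) =
      (∑ σ : Fin 2, μ σ) * ((nh : ℝ) / (L : ℝ) ^ d - ν) := by rw [Finset.sum_mul]
  rw [hs] at hmain
  exact hmain

/-- **For every ground state of the sector** (`κ ≥ 0` and a certified torus energy bound
`groundEnergyAt (fermionTorusGraph d L) t U (2n) / L^d ≤ u`): EVERY unit ground state `ψ` of the
sector `(2n, S^z = 0)` — every vector of a degenerate ground level — obeys
`c − Σₖ ‖aₖ‖ + (Σ_σ μ_σ)(n/L^d − ν) ≤ Re ω̄_ψ(Γ(ι_{Λ',L}) X)`. [cite: WangEtAl2024, §III] -/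
theorem re_orbitState_ge_of_window_certificate_aff_groundState (t U : ℝ) (hL : 3 ≤ L) {nh : ℕ}
    (hn : nh ≤ Fintype.card (FermionTorus d L))
    {Λ Λ' : Finset (Site d)} (hΛ : Λ ⊆ Λ')
    (hclosed : ∀ x ∈ Λ, ∀ i : Fin d, x + unitVec i ∈ Λ' ∧ x - unitVec i ∈ Λ')
    (h0 : thicken ({0} : Finset (Site d)) 1 ⊆ Λ') (hz : (0 : Site d) ∈ Λ')
    (hInj : Set.InjOn (Torus.proj (d := d) L) ↑(thicken Λ' 1))
    (hInj' : Set.InjOn (Torus.proj (d := d) L) ↑Λ')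
    {S : Finset ℤˣ} (h1 : (1 : ℤˣ) ∈ S) (hmul : ∀ a ∈ S, ∀ b ∈ S, a * b ∈ S)
    {ψ : Fock (Orb (FermionTorus d L))}
    (hGS : IsGroundStateInSector (hubbardTorus d L t U) (2 * nh) 0 ψ) (hψ1 : star ψ ⬝ᵥ ψ = 1)
    {κ u : ℝ} (hκ : 0 ≤ κ) (hu : groundEnergyAt (fermionTorusGraph d L) t U (2 * nh) / (L : ℝ) ^ d ≤ u)
    (Xw : FermionOp Λ') (μ : Fin 2 → ℝ) (ν : ℝ)
    {m : Type*} [Fintype m] [DecidableEq m] {Λm : Matrix m m ℂ} (hΛm : Λm.PosSemidef)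
    (O : m → FermionOp Λ')
    {κ' : Type*} (s : Finset κ') (B : κ' → FermionOp Λ)
    {ι : Type*} (tt : Finset ι) (ε : ι → ℤˣ) (hεS : ∀ l ∈ tt, ε l ∈ S) (vv : ι → Site d)
    (hsh : ∀ l, affShiftSet (ε l) (vv l) Λ ⊆ Λ') (Y : ι → FermionOp Λ)
    {ρ : Type*} (uu : Finset ρ) (b : ρ → ℂ) (cw : ρ → List (Orb (PolySite Λ') × Bool))
    (hcw : ∀ j ∈ uu, ladderCharge (cw j) ≠ 0 ∨ ladderSpinCharge (cw j) ≠ 0)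
    {δ : Type*} (ah : Finset δ) (dc : δ → ℝ) (V : δ → FermionOp Λ')
    {κ'' : Type*} (w : Finset κ'') (a : κ'' → ℂ) (word : κ'' → List (Orb (PolySite Λ') × Bool)) {c : ℝ}
    (hcert : Xw - (c : ℂ) • (1 : FermionOp Λ') -
        ∑ σ : Fin 2, ((μ σ : ℝ) : ℂ) • (nAt 0 hz σ - ((ν : ℝ) : ℂ) • (1 : FermionOp Λ')) -
        ((κ : ℝ) : ℂ) • (((u : ℝ) : ℂ) • (1 : FermionOp Λ') -
          fermionEmbed (PolySite.incl h0) ((hubbardFermionInteraction d t U).meanEnergyObs 1)) =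
      gramForm Λm O +
        (∑ k ∈ s, ((hubbardFermionInteraction d t U).localHamiltonian Λ' * fermionEmbed (PolySite.incl hΛ) (B k) -
            fermionEmbed (PolySite.incl hΛ) (B k) * (hubbardFermionInteraction d t U).localHamiltonian Λ') +
          ∑ l ∈ tt, (fermionEmbed (PolySite.incl (hsh l)) (fermionEmbed (PolySite.affEmb (ε l) (vv l) Λ) (Y l)) -
            fermionEmbed (PolySite.incl hΛ) (Y l)) +
          ∑ j ∈ uu, b j • ladderWord (cw j)) +
        (∑ m' ∈ ah, ((dc m' : ℝ) : ℂ) • ((V m')ᴴ - V m') + ∑ k ∈ w, a k • ladderWord (word k))) :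
    c - ∑ k ∈ w, ‖a k‖ + (∑ σ : Fin 2, μ σ) * ((nh : ℝ) / (L : ℝ) ^ d - ν) ≤
      (orbitState (fun g : TorusSite d L × ↥S => (fockAff (g.2 : ℤˣ) g.1).val) ψ
        (fermionEmbed (PolySite.toTorusEmb L hInj') Xw)).re := by
  have hψK : ψ ∈ (szSector (2 * nh) 0 : Submodule ℂ (Fock (Orb (FermionTorus d L)))) := hGS.1
  have hHψ : hubbardTorus d L t U *ᵥ ψ =
      ((groundEnergyAt (fermionTorusGraph d L) t U (2 * nh) : ℝ) : ℂ) • ψ := by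
    rw [groundEnergyAt_eq_minEnergyOn_szSector (fermionTorusGraph d L) t U hn]
    exact hGS.2.2
  have h := re_orbitState_ge_of_window_certificate_aff_ineq t U hL hΛ hclosed h0 hz hInj hInj' h1 hmul hψK
    hψ1 hHψ Xw κ u μ ν hΛm O s B tt ε hεS vv hsh Y uu b cw hcw ah dc V w a word hcert
  have hslack : 0 ≤ κ * (u - groundEnergyAt (fermionTorusGraph d L) t U (2 * nh) / (L : ℝ) ^ d) :=
    mul_nonneg hκ (sub_nonneg.2 hu)
  linarith

end Window

/-! ### The dictionary: affine orbit states versus translation averages -/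

section Dictionary

variable {d L : ℕ} [NeZero L]

/-- Expectation in a conjugated vector: `⟨Mᴴ φ, A Mᴴ φ⟩ = ⟨φ, (M A Mᴴ) φ⟩`. [folklore] -/
private theorem expect_conjTranspose_mulVec' {ι : Type*} [LinearOrder ι] [Fintype ι]
    (A M : Matrix (Finset ι) (Finset ι) ℂ) (φ : Fock ι) :
    expect A (Mᴴ *ᵥ φ) = expect (M * A * Mᴴ) φ := by
  unfold expect
  rw [star_mulVec, conjTranspose_conjTranspose, ← dotProduct_mulVec, mulVec_mulVec, mulVec_mulVec]

/-- `Torus.proj L 0 = 0`. [folklore] -/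
private theorem proj_zero_aff (L : ℕ) : Torus.proj L (0 : Site d) = 0 := by
  funext i
  simp [Torus.proj]

/-- **The affine orbit state is a mean of translation averages**: for every torus operator `X`,
`ω̄_ψ(X) = |S|⁻¹ Σ_{ε∈S} L^{-d} Σ_v ⟨U_v ψ, (U_{ε,0} X U_{ε,0}ᴴ) U_v ψ⟩`
(`U_{ε,w}ᴴ ψ = U_{ε,0}ᴴ U_{−w} ψ`, and `w ↦ −w` is a bijection of the torus).
[cite: BratteliRobinsonII1997, §6.2.4] -/
theorem orbitState_affineUnitary_eq_sum_expect_conj (S : Finset ℤˣ) (ψ : Fock (Orb (FermionTorus d L)))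
    (X : Matrix (Finset (Orb (FermionTorus d L))) (Finset (Orb (FermionTorus d L))) ℂ) :
    orbitState (fun g : TorusSite d L × ↥S => (fockAff (g.2 : ℤˣ) g.1).val) ψ X =
      (S.card : ℂ)⁻¹ * ∑ ε ∈ S, (((Fintype.card (TorusSite d L) : ℂ))⁻¹ *
        ∑ v : TorusSite d L, expect ((fockAff ε (0 : TorusSite d L)).val * X * (fockAff ε (0 : TorusSite d L)).valᴴ)
          ((fockTranslate v).val *ᵥ ψ)) := by
  rw [orbitState_apply, Fintype.card_prod, Fintype.card_coe, Nat.cast_mul, ← Finset.mul_sum, ← mul_assoc,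
    ← _root_.mul_inv_rev, ← Finset.sum_coe_sort S]
  conv_lhs => rw [Fintype.sum_prod_type, Finset.sum_comm]
  refine congrArg _ (Finset.sum_congr rfl fun ε _ => ?_)
  -- reindex `w ↦ -w` and move `U_{ε,0}ᴴ` onto the observable
  refine Fintype.sum_equiv (Equiv.neg (TorusSite d L)) _ _ fun w => ?_
  rw [_root_.Literature.MathematicalPhysics.QuantumManyBody.StateRelaxation.vectorState_apply,
    fockAff_val_conjTranspose_mulVec, Equiv.neg_apply]
  exact expect_conjTranspose_mulVec' X _ _

/-- **The dictionary for window observables**: for a window `Λ'` fitting into the torus and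
`X ∈ 𝔄_{Λ'}`, the affine orbit state of `ψ` on the pull-back `Γ(ι_{Λ',L}) X` is the mean over `ε ∈ S`
of the TRANSLATION-averaged expectations in `ψ` of the reflected window observables
`Γ(affEmb ε 0) X ∈ 𝔄_{εΛ'}`:
`ω̄_ψ(Γ(ι_{Λ'}) X) = |S|⁻¹ Σ_{ε∈S} torusAvgExpectAt L (εΛ') (Γ(affEmb ε 0) X) ψ`
(`U_{ε,0} Γ(ι_{Λ'}) X U_{ε,0}ᴴ = Γ(ι_{εΛ'})(Γ(affEmb ε 0) X)`, `fermionEmbed_toTorusEmb_affEmb`).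
[cite: BratteliRobinsonII1997, §6.2.4] -/
theorem orbitState_affineUnitary_fermionEmbed_toTorusEmb (S : Finset ℤˣ)
    {Λ' : Finset (Site d)} (hInj' : Set.InjOn (Torus.proj (d := d) L) ↑Λ')
    (Xw : FermionOp Λ') (ψ : Fock (Orb (FermionTorus d L))) :
    orbitState (fun g : TorusSite d L × ↥S => (fockAff (g.2 : ℤˣ) g.1).val) ψ
        (fermionEmbed (PolySite.toTorusEmb L hInj') Xw) =
      (S.card : ℂ)⁻¹ * ∑ ε ∈ S,
        torusAvgExpectAt L (affShiftSet ε 0 Λ') (fermionEmbed (PolySite.affEmb ε 0 Λ') Xw) ψ := by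
  rw [orbitState_affineUnitary_eq_sum_expect_conj S]
  refine congrArg _ (Finset.sum_congr rfl fun ε _ => ?_)
  have hInjε : Set.InjOn (Torus.proj (d := d) L) ↑(affShiftSet ε 0 Λ') :=
    (injOn_proj_affShiftSet_iff L ε 0 Λ').2 hInj'
  rw [torusAvgExpectAt_of_injOn L hInjε]
  refine congrArg _ (Finset.sum_congr rfl fun v _ => ?_)
  congr 1
  rw [fermionEmbed_toTorusEmb_affEmb ε 0 hInj' hInjε Xw, proj_zero_aff, fockAff_conj]

/-- Real parts of the dictionary. [cite: BratteliRobinsonII1997, §6.2.4] -/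
theorem re_orbitState_affineUnitary_fermionEmbed_toTorusEmb (S : Finset ℤˣ)
    {Λ' : Finset (Site d)} (hInj' : Set.InjOn (Torus.proj (d := d) L) ↑Λ')
    (Xw : FermionOp Λ') (ψ : Fock (Orb (FermionTorus d L))) :
    (orbitState (fun g : TorusSite d L × ↥S => (fockAff (g.2 : ℤˣ) g.1).val) ψ
        (fermionEmbed (PolySite.toTorusEmb L hInj') Xw)).re =
      (S.card : ℝ)⁻¹ * ∑ ε ∈ S,
        (torusAvgExpectAt L (affShiftSet ε 0 Λ') (fermionEmbed (PolySite.affEmb ε 0 Λ') Xw) ψ).re := by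
  rw [orbitState_affineUnitary_fermionEmbed_toTorusEmb S hInj', ← Complex.ofReal_natCast,
    ← Complex.ofReal_inv, Complex.re_ofReal_mul, Complex.re_sum]

end Dictionary

/-! ### The trivial label `ε = 1`, `v = 0` -/

section TrivialLabel

variable {d : ℕ}

/-- `affSite 1 0 = id`. [folklore] -/
private theorem affSite_one_zero (x : Site d) : affSite 1 0 x = x := by
  funext i
  rw [affSite_apply, Units.val_one, one_mul, Pi.zero_apply, add_zero]

/-- A region lies inside its trivial affine image `1·Λ + 0` (indeed equals it). [folklore] -/
private theorem subset_affShiftSet_one_zero (Λ : Finset (Site d)) : Λ ⊆ affShiftSet 1 0 Λ := by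
  intro x hx
  have h := affSite_mem_affShiftSet (1 : ℤˣ) (0 : Site d) hx
  rwa [affSite_one_zero] at h

/-- The trivial affine map `affEmb 1 0 Λ` is the inclusion `Λ ⊆ 1·Λ + 0`. [folklore] -/
private theorem PolySite.affEmb_one_zero_apply {Λ : Finset (Site d)} (y : PolySite Λ) :
    PolySite.affEmb 1 0 Λ y = PolySite.incl (subset_affShiftSet_one_zero Λ) y := by
  refine Subtype.ext ?_
  show toLex (affSite 1 0 (ofLex y.1)) = y.1
  rw [affSite_one_zero]
  rfl

/-- Every infinite-volume state takes the same value on `Γ(affEmb 1 0 Λ) A ∈ 𝔄_{1·Λ+0}` as on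
`A ∈ 𝔄_Λ` (compatibility of the local functionals). [cite: ArakiMoriya2003, §4.1 Def. 4.1 (2)] -/
theorem InfVolFermionState.expect_fermionEmbed_affEmb_one_zero (ω : InfVolFermionState d)
    {Λ : Finset (Site d)} (A : FermionOp Λ) :
    ω.expect (affShiftSet 1 0 Λ) (fermionEmbed (PolySite.affEmb 1 0 Λ) A) = ω.expect Λ A := by
  rw [fermionEmbed_congr (fun y => PolySite.affEmb_one_zero_apply y), ω.compatible]

end TrivialLabel

/-! ### The thermodynamic limit: doped torus-limit ground states of the chain -/

section ChainLimit

/-- A sector ground state is an `N`-particle vector. [folklore] -/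
private theorem IsGroundStateInSector.isNParticle' {L : ℕ}
    {H : Matrix (Finset (Orb (FermionTorus 1 L))) (Finset (Orb (FermionTorus 1 L))) ℂ} {N : ℕ} {M : ℝ}
    {ψ : Fock (Orb (FermionTorus 1 L))} (h : IsGroundStateInSector H N M ψ) : IsNParticle N ψ :=
  ((mem_szSector_iff N M ψ).1 h.1).1

/-- **Window certificate with an energy constraint ⇒ reflection-orbit-mean correlator bound for every
DOPED torus-limit ground state of the Hubbard chain.** Data: the chain window identity of
`re_orbitState_ge_of_window_certificate_aff_ineq` (`d = 1`; affine labels `εₗ ∈ S`, `S ∋ 1` closed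
under multiplication), `κ ≥ 0`, `U ≥ 0`, a filling `p/q` (`1 ≤ q`, `p ≤ 2q`) and the
thermodynamic-limit energy bound `hubbardChainEnergyDensityAt t U p q ≤ u`. Let `m_j → ∞`, let `ψ_j`
be unit ground states of the sectors `(2n_j, S^z = 0)` of the rings of length `q·m_j` with
`2n_j = p·m_j` (filling exactly `p/q`), and `ω` a torus limit of `ψ` along `j ↦ q·m_j`. Then
`c − Σₖ ‖aₖ‖ + (Σ_σ μ_σ)(p/(2q) − ν) ≤ |S|⁻¹ Σ_{ε∈S} Re ω_{εΛ'}(Γ(affEmb ε 0) X)`.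
(Finite rings: the orbit bound with slack `κ (u − E_L/L)`; dictionary; `E_{qm}(pm)/(qm) → e(p/q)`
(`tendsto_hubbardChainEnergyDensityAt`); the limit slack `κ (u − e) ≥ 0` is dropped.)
Wang et al. 2024 §III; Han 2020 §3; Ruelle 1969 §2.2. [cite: WangEtAl2024, §III] -/
theorem InfVolFermionState.IsTorusLimitOf.re_sum_expect_aff_ge_of_chain_window_certificate_ineq
    (t : ℝ) {U : ℝ} (hU : 0 ≤ U) {p q : ℕ} (hq : 1 ≤ q) (hp : p ≤ 2 * q) {κ u : ℝ} (hκ : 0 ≤ κ)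
    (hu : ThermodynamicLimit.hubbardChainEnergyDensityAt t U p q ≤ u)
    {Λ Λ' : Finset (Site 1)} (hΛ : Λ ⊆ Λ')
    (hclosed : ∀ x ∈ Λ, ∀ i : Fin 1, x + unitVec i ∈ Λ' ∧ x - unitVec i ∈ Λ')
    (h0 : thicken ({0} : Finset (Site 1)) 1 ⊆ Λ') (hz : (0 : Site 1) ∈ Λ')
    {S : Finset ℤˣ} (h1 : (1 : ℤˣ) ∈ S) (hmul : ∀ a ∈ S, ∀ b ∈ S, a * b ∈ S)
    (Xw : FermionOp Λ') (μ : Fin 2 → ℝ) (ν : ℝ)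
    {m : Type*} [Fintype m] [DecidableEq m] {Λm : Matrix m m ℂ} (hΛm : Λm.PosSemidef)
    (O : m → FermionOp Λ')
    {κ' : Type*} (s : Finset κ') (B : κ' → FermionOp Λ)
    {ι : Type*} (tt : Finset ι) (ε : ι → ℤˣ) (hεS : ∀ l ∈ tt, ε l ∈ S) (vv : ι → Site 1)
    (hsh : ∀ l, affShiftSet (ε l) (vv l) Λ ⊆ Λ') (Y : ι → FermionOp Λ)
    {ρ : Type*} (uu : Finset ρ) (b : ρ → ℂ) (cw : ρ → List (Orb (PolySite Λ') × Bool))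
    (hcw : ∀ j ∈ uu, ladderCharge (cw j) ≠ 0 ∨ ladderSpinCharge (cw j) ≠ 0)
    {δ : Type*} (ah : Finset δ) (dc : δ → ℝ) (V : δ → FermionOp Λ')
    {κ'' : Type*} (w : Finset κ'') (a : κ'' → ℂ) (word : κ'' → List (Orb (PolySite Λ') × Bool)) {c : ℝ}
    (hcert : Xw - (c : ℂ) • (1 : FermionOp Λ') -
        ∑ σ : Fin 2, ((μ σ : ℝ) : ℂ) • (nAt 0 hz σ - ((ν : ℝ) : ℂ) • (1 : FermionOp Λ')) -
        ((κ : ℝ) : ℂ) • (((u : ℝ) : ℂ) • (1 : FermionOp Λ') -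
          fermionEmbed (PolySite.incl h0) ((hubbardFermionInteraction 1 t U).meanEnergyObs 1)) =
      gramForm Λm O +
        (∑ k ∈ s, ((hubbardFermionInteraction 1 t U).localHamiltonian Λ' * fermionEmbed (PolySite.incl hΛ) (B k) -
            fermionEmbed (PolySite.incl hΛ) (B k) * (hubbardFermionInteraction 1 t U).localHamiltonian Λ') +
          ∑ l ∈ tt, (fermionEmbed (PolySite.incl (hsh l)) (fermionEmbed (PolySite.affEmb (ε l) (vv l) Λ) (Y l)) -
            fermionEmbed (PolySite.incl hΛ) (Y l)) +
          ∑ j ∈ uu, b j • ladderWord (cw j)) +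
        (∑ m' ∈ ah, ((dc m' : ℝ) : ℂ) • ((V m')ᴴ - V m') + ∑ k ∈ w, a k • ladderWord (word k)))
    {mseq : ℕ → ℕ} (hm : Tendsto mseq atTop atTop) {nh : ℕ → ℕ} (hnh : ∀ j, 2 * nh j = p * mseq j)
    {ψ : ∀ L, Fock (Orb (FermionTorus 1 L))}
    (hψ : ∀ j, IsGroundStateInSector (hubbardTorus 1 (q * mseq j) t U) (2 * nh j) 0 (ψ (q * mseq j)))
    (hψ1 : ∀ j, star (ψ (q * mseq j)) ⬝ᵥ ψ (q * mseq j) = 1)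
    {ω : InfVolFermionState 1} (hω : ω.IsTorusLimitOf ψ (fun j => q * mseq j)) :
    c - ∑ k ∈ w, ‖a k‖ + (∑ σ : Fin 2, μ σ) * ((p : ℝ) / (2 * q) - ν) ≤
      (S.card : ℝ)⁻¹ * ∑ e ∈ S,
        (ω.expect (affShiftSet e 0 Λ') (fermionEmbed (PolySite.affEmb e 0 Λ') Xw)).re := by
  have hLs : Tendsto (fun j => q * mseq j) atTop atTop :=
    Filter.tendsto_id.const_mul_atTop' (by omega : 0 < q) |>.comp hm
  -- the averaged torus expectations of the reflected observables converge to their values in `ω`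
  have hterm : ∀ e ∈ S, Tendsto (fun j =>
      (torusAvgExpect (q * mseq j) (affShiftSet e 0 Λ') (fermionEmbed (PolySite.affEmb e 0 Λ') Xw)
        (ψ (q * mseq j))).re) atTop
      (𝓝 (ω.expect (affShiftSet e 0 Λ') (fermionEmbed (PolySite.affEmb e 0 Λ') Xw)).re) := fun e _ =>
    (Complex.continuous_re.tendsto _).comp (hω (affShiftSet e 0 Λ') _)
  have hlim : Tendsto (fun j => (S.card : ℝ)⁻¹ * ∑ e ∈ S,
      (torusAvgExpect (q * mseq j) (affShiftSet e 0 Λ') (fermionEmbed (PolySite.affEmb e 0 Λ') Xw)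
        (ψ (q * mseq j))).re) atTop
      (𝓝 ((S.card : ℝ)⁻¹ * ∑ e ∈ S,
        (ω.expect (affShiftSet e 0 Λ') (fermionEmbed (PolySite.affEmb e 0 Λ') Xw)).re)) :=
    (tendsto_finsetSum S hterm).const_mul _
  -- the energies per site converge to the thermodynamic-limit density at filling `p/q`
  have hE : Tendsto (fun j => groundEnergyAt (fermionTorusGraph 1 (q * mseq j)) t U (2 * nh j) /
      ((q * mseq j : ℕ) : ℝ)) atTop (𝓝 (ThermodynamicLimit.hubbardChainEnergyDensityAt t U p q)) := by
    have h := (ThermodynamicLimit.tendsto_hubbardChainEnergyDensityAt t hU hq hp).comp hm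
    refine h.congr fun j => ?_
    simp only [Function.comp_apply, hnh j]
  set b0 : ℝ := c - ∑ k ∈ w, ‖a k‖ + (∑ σ : Fin 2, μ σ) * ((p : ℝ) / (2 * q) - ν) with hb0
  have hbnd : Tendsto (fun j => b0 +
      κ * (u - groundEnergyAt (fermionTorusGraph 1 (q * mseq j)) t U (2 * nh j) / ((q * mseq j : ℕ) : ℝ)))
      atTop (𝓝 (b0 + κ * (u - ThermodynamicLimit.hubbardChainEnergyDensityAt t U p q))) :=
    tendsto_const_nhds.add ((tendsto_const_nhds.sub hE).const_mul κ)
  -- the finite-ring inequality holds for all large `j`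
  have hev' : ∀ᶠ j in atTop, b0 +
      κ * (u - groundEnergyAt (fermionTorusGraph 1 (q * mseq j)) t U (2 * nh j) / ((q * mseq j : ℕ) : ℝ)) ≤
      (S.card : ℝ)⁻¹ * ∑ e ∈ S,
        (torusAvgExpect (q * mseq j) (affShiftSet e 0 Λ') (fermionEmbed (PolySite.affEmb e 0 Λ') Xw)
          (ψ (q * mseq j))).re := by
    filter_upwards [eventually_injOn_proj_of_tendsto (thicken Λ' 1) hLs, hLs.eventually_ge_atTop 3]
      with j hInj hL3
    haveI : NeZero (q * mseq j) := ⟨by omega⟩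
    have hInj' : Set.InjOn (Torus.proj (d := 1) (q * mseq j)) ↑Λ' :=
      hInj.mono (by exact_mod_cast subset_thicken Λ' 1)
    obtain ⟨hψK, -, hHψ⟩ := hψ j
    have hnle : nh j ≤ q * mseq j := by
      have h2 : 2 * nh j ≤ 2 * (q * mseq j) := by
        rw [hnh j, ← mul_assoc]
        exact Nat.mul_le_mul_right _ hp
      exact Nat.le_of_mul_le_mul_left h2 two_pos
    have hn : nh j ≤ Fintype.card (FermionTorus 1 (q * mseq j)) := by simpa using hnle
    rw [show (hubbardTorus 1 (q * mseq j) t U).minEnergyOn (szSector (2 * nh j) 0) =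
        groundEnergyAt (fermionTorusGraph 1 (q * mseq j)) t U (2 * nh j) from
      (groundEnergyAt_eq_minEnergyOn_szSector (fermionTorusGraph 1 (q * mseq j)) t U hn).symm] at hHψ
    have h := re_orbitState_ge_of_window_certificate_aff_ineq t U hL3 hΛ hclosed h0 hz hInj hInj' h1 hmul
      hψK (hψ1 j) hHψ Xw κ u μ ν hΛm O s B tt ε hεS vv hsh Y uu b cw hcw ah dc V w a word hcert
    rw [re_orbitState_affineUnitary_fermionEmbed_toTorusEmb S hInj', pow_one] at h
    -- the per-spin density of the sector is exactly `p/(2q)`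
    have hfill : ((nh j : ℕ) : ℝ) / ((q * mseq j : ℕ) : ℝ) = (p : ℝ) / (2 * q) := by
      have hq0 : (0 : ℝ) < (q : ℝ) := by exact_mod_cast hq
      have h2 : (2 : ℝ) * (nh j : ℝ) = (p : ℝ) * (mseq j : ℝ) := by exact_mod_cast hnh j
      rw [div_eq_div_iff (Nat.cast_ne_zero.2 (by omega)) (mul_ne_zero two_ne_zero hq0.ne')]
      push_cast
      linear_combination (q : ℝ) * h2
    rw [hfill] at h
    simp_rw [torusAvgExpect_eq]
    exact h
  have hle := le_of_tendsto_of_tendsto hbnd hlim hev'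
  have hslack : 0 ≤ κ * (u - ThermodynamicLimit.hubbardChainEnergyDensityAt t U p q) :=
    mul_nonneg hκ (sub_nonneg.2 hu)
  linarith

/-- **Translation-only chain certificates ⇒ the correlator of every doped torus-limit ground state.**
Under the hypotheses of `…re_sum_expect_aff_ge_of_chain_window_certificate_ineq` with all affine labels
trivial (`εₗ = 1`, translations `x ↦ x + vₗ` only), every torus limit `ω` obeys
`c − Σₖ ‖aₖ‖ + (Σ_σ μ_σ)(p/(2q) − ν) ≤ Re ω_{Λ'}(X)` as soon as `hubbardChainEnergyDensityAt t U p q ≤ u`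
— the doped counterpart of `IsTorusLimitOf.re_expect_ge_of_chain_window_certificate_ineq`.
[cite: WangEtAl2024, §III] -/
theorem InfVolFermionState.IsTorusLimitOf.re_expect_ge_of_chain_window_certificate_ineq_filling
    (t : ℝ) {U : ℝ} (hU : 0 ≤ U) {p q : ℕ} (hq : 1 ≤ q) (hp : p ≤ 2 * q) {κ u : ℝ} (hκ : 0 ≤ κ)
    (hu : ThermodynamicLimit.hubbardChainEnergyDensityAt t U p q ≤ u)
    {Λ Λ' : Finset (Site 1)} (hΛ : Λ ⊆ Λ')
    (hclosed : ∀ x ∈ Λ, ∀ i : Fin 1, x + unitVec i ∈ Λ' ∧ x - unitVec i ∈ Λ')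
    (h0 : thicken ({0} : Finset (Site 1)) 1 ⊆ Λ') (hz : (0 : Site 1) ∈ Λ')
    (Xw : FermionOp Λ') (μ : Fin 2 → ℝ) (ν : ℝ)
    {m : Type*} [Fintype m] [DecidableEq m] {Λm : Matrix m m ℂ} (hΛm : Λm.PosSemidef)
    (O : m → FermionOp Λ')
    {κ' : Type*} (s : Finset κ') (B : κ' → FermionOp Λ)
    {ι : Type*} (tt : Finset ι) (ε : ι → ℤˣ) (hε1 : ∀ l ∈ tt, ε l = 1) (vv : ι → Site 1)
    (hsh : ∀ l, affShiftSet (ε l) (vv l) Λ ⊆ Λ') (Y : ι → FermionOp Λ)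
    {ρ : Type*} (uu : Finset ρ) (b : ρ → ℂ) (cw : ρ → List (Orb (PolySite Λ') × Bool))
    (hcw : ∀ j ∈ uu, ladderCharge (cw j) ≠ 0 ∨ ladderSpinCharge (cw j) ≠ 0)
    {δ : Type*} (ah : Finset δ) (dc : δ → ℝ) (V : δ → FermionOp Λ')
    {κ'' : Type*} (w : Finset κ'') (a : κ'' → ℂ) (word : κ'' → List (Orb (PolySite Λ') × Bool)) {c : ℝ}
    (hcert : Xw - (c : ℂ) • (1 : FermionOp Λ') -
        ∑ σ : Fin 2, ((μ σ : ℝ) : ℂ) • (nAt 0 hz σ - ((ν : ℝ) : ℂ) • (1 : FermionOp Λ')) -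
        ((κ : ℝ) : ℂ) • (((u : ℝ) : ℂ) • (1 : FermionOp Λ') -
          fermionEmbed (PolySite.incl h0) ((hubbardFermionInteraction 1 t U).meanEnergyObs 1)) =
      gramForm Λm O +
        (∑ k ∈ s, ((hubbardFermionInteraction 1 t U).localHamiltonian Λ' * fermionEmbed (PolySite.incl hΛ) (B k) -
            fermionEmbed (PolySite.incl hΛ) (B k) * (hubbardFermionInteraction 1 t U).localHamiltonian Λ') +
          ∑ l ∈ tt, (fermionEmbed (PolySite.incl (hsh l)) (fermionEmbed (PolySite.affEmb (ε l) (vv l) Λ) (Y l)) -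
            fermionEmbed (PolySite.incl hΛ) (Y l)) +
          ∑ j ∈ uu, b j • ladderWord (cw j)) +
        (∑ m' ∈ ah, ((dc m' : ℝ) : ℂ) • ((V m')ᴴ - V m') + ∑ k ∈ w, a k • ladderWord (word k)))
    {mseq : ℕ → ℕ} (hm : Tendsto mseq atTop atTop) {nh : ℕ → ℕ} (hnh : ∀ j, 2 * nh j = p * mseq j)
    {ψ : ∀ L, Fock (Orb (FermionTorus 1 L))}
    (hψ : ∀ j, IsGroundStateInSector (hubbardTorus 1 (q * mseq j) t U) (2 * nh j) 0 (ψ (q * mseq j)))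
    (hψ1 : ∀ j, star (ψ (q * mseq j)) ⬝ᵥ ψ (q * mseq j) = 1)
    {ω : InfVolFermionState 1} (hω : ω.IsTorusLimitOf ψ (fun j => q * mseq j)) :
    c - ∑ k ∈ w, ‖a k‖ + (∑ σ : Fin 2, μ σ) * ((p : ℝ) / (2 * q) - ν) ≤ (ω.expect Λ' Xw).re := by
  have h1 : (1 : ℤˣ) ∈ ({1} : Finset ℤˣ) := Finset.mem_singleton_self 1
  have hmul : ∀ a ∈ ({1} : Finset ℤˣ), ∀ b ∈ ({1} : Finset ℤˣ), a * b ∈ ({1} : Finset ℤˣ) := by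
    intro a ha b hb
    rw [Finset.mem_singleton] at ha hb ⊢
    rw [ha, hb, mul_one]
  have hεS : ∀ l ∈ tt, ε l ∈ ({1} : Finset ℤˣ) := fun l hl => Finset.mem_singleton.2 (hε1 l hl)
  have h := hω.re_sum_expect_aff_ge_of_chain_window_certificate_ineq t hU hq hp hκ hu hΛ hclosed h0 hz h1
    hmul Xw μ ν hΛm O s B tt ε hεS vv hsh Y uu b cw hcw ah dc V w a word hcert hm hnh hψ hψ1
  rwa [Finset.sum_singleton, Finset.card_singleton, Nat.cast_one, inv_one, one_mul,
    ω.expect_fermionEmbed_affEmb_one_zero] at h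

/-- **Reflection-symmetric torus limits** (or reflection-symmetric objectives): under the hypotheses of
`…re_sum_expect_aff_ge_of_chain_window_certificate_ineq`, if `ω` takes the same value on every reflected
copy `Γ(affEmb ε 0) X ∈ 𝔄_{εΛ'}` (`ε ∈ S`) as on `X`, the `S`-reduced certificate bounds
`Re ω_{Λ'}(X)` itself. [cite: WangEtAl2024, §III] -/
theorem InfVolFermionState.IsTorusLimitOf.re_expect_ge_of_chain_window_certificate_ineq_filling_of_invariant
    (t : ℝ) {U : ℝ} (hU : 0 ≤ U) {p q : ℕ} (hq : 1 ≤ q) (hp : p ≤ 2 * q) {κ u : ℝ} (hκ : 0 ≤ κ)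
    (hu : ThermodynamicLimit.hubbardChainEnergyDensityAt t U p q ≤ u)
    {Λ Λ' : Finset (Site 1)} (hΛ : Λ ⊆ Λ')
    (hclosed : ∀ x ∈ Λ, ∀ i : Fin 1, x + unitVec i ∈ Λ' ∧ x - unitVec i ∈ Λ')
    (h0 : thicken ({0} : Finset (Site 1)) 1 ⊆ Λ') (hz : (0 : Site 1) ∈ Λ')
    {S : Finset ℤˣ} (h1 : (1 : ℤˣ) ∈ S) (hmul : ∀ a ∈ S, ∀ b ∈ S, a * b ∈ S)
    (Xw : FermionOp Λ') (μ : Fin 2 → ℝ) (ν : ℝ)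
    {m : Type*} [Fintype m] [DecidableEq m] {Λm : Matrix m m ℂ} (hΛm : Λm.PosSemidef)
    (O : m → FermionOp Λ')
    {κ' : Type*} (s : Finset κ') (B : κ' → FermionOp Λ)
    {ι : Type*} (tt : Finset ι) (ε : ι → ℤˣ) (hεS : ∀ l ∈ tt, ε l ∈ S) (vv : ι → Site 1)
    (hsh : ∀ l, affShiftSet (ε l) (vv l) Λ ⊆ Λ') (Y : ι → FermionOp Λ)
    {ρ : Type*} (uu : Finset ρ) (b : ρ → ℂ) (cw : ρ → List (Orb (PolySite Λ') × Bool))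
    (hcw : ∀ j ∈ uu, ladderCharge (cw j) ≠ 0 ∨ ladderSpinCharge (cw j) ≠ 0)
    {δ : Type*} (ah : Finset δ) (dc : δ → ℝ) (V : δ → FermionOp Λ')
    {κ'' : Type*} (w : Finset κ'') (a : κ'' → ℂ) (word : κ'' → List (Orb (PolySite Λ') × Bool)) {c : ℝ}
    (hcert : Xw - (c : ℂ) • (1 : FermionOp Λ') -
        ∑ σ : Fin 2, ((μ σ : ℝ) : ℂ) • (nAt 0 hz σ - ((ν : ℝ) : ℂ) • (1 : FermionOp Λ')) -
        ((κ : ℝ) : ℂ) • (((u : ℝ) : ℂ) • (1 : FermionOp Λ') -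
          fermionEmbed (PolySite.incl h0) ((hubbardFermionInteraction 1 t U).meanEnergyObs 1)) =
      gramForm Λm O +
        (∑ k ∈ s, ((hubbardFermionInteraction 1 t U).localHamiltonian Λ' * fermionEmbed (PolySite.incl hΛ) (B k) -
            fermionEmbed (PolySite.incl hΛ) (B k) * (hubbardFermionInteraction 1 t U).localHamiltonian Λ') +
          ∑ l ∈ tt, (fermionEmbed (PolySite.incl (hsh l)) (fermionEmbed (PolySite.affEmb (ε l) (vv l) Λ) (Y l)) -
            fermionEmbed (PolySite.incl hΛ) (Y l)) +
          ∑ j ∈ uu, b j • ladderWord (cw j)) +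
        (∑ m' ∈ ah, ((dc m' : ℝ) : ℂ) • ((V m')ᴴ - V m') + ∑ k ∈ w, a k • ladderWord (word k)))
    {mseq : ℕ → ℕ} (hm : Tendsto mseq atTop atTop) {nh : ℕ → ℕ} (hnh : ∀ j, 2 * nh j = p * mseq j)
    {ψ : ∀ L, Fock (Orb (FermionTorus 1 L))}
    (hψ : ∀ j, IsGroundStateInSector (hubbardTorus 1 (q * mseq j) t U) (2 * nh j) 0 (ψ (q * mseq j)))
    (hψ1 : ∀ j, star (ψ (q * mseq j)) ⬝ᵥ ψ (q * mseq j) = 1)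
    {ω : InfVolFermionState 1} (hω : ω.IsTorusLimitOf ψ (fun j => q * mseq j))
    (hinv : ∀ e ∈ S, ω.expect (affShiftSet e 0 Λ') (fermionEmbed (PolySite.affEmb e 0 Λ') Xw) = ω.expect Λ' Xw) :
    c - ∑ k ∈ w, ‖a k‖ + (∑ σ : Fin 2, μ σ) * ((p : ℝ) / (2 * q) - ν) ≤ (ω.expect Λ' Xw).re := by
  have h := hω.re_sum_expect_aff_ge_of_chain_window_certificate_ineq t hU hq hp hκ hu hΛ hclosed h0 hz h1
    hmul Xw μ ν hΛm O s B tt ε hεS vv hsh Y uu b cw hcw ah dc V w a word hcert hm hnh hψ hψ1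
  have hsum : ∑ e ∈ S, (ω.expect (affShiftSet e 0 Λ') (fermionEmbed (PolySite.affEmb e 0 Λ') Xw)).re =
      (S.card : ℝ) * (ω.expect Λ' Xw).re := by
    rw [Finset.sum_congr rfl fun e he => by rw [hinv e he], Finset.sum_const, nsmul_eq_mul]
  have hcard : (S.card : ℝ) ≠ 0 := Nat.cast_ne_zero.2 (Finset.card_pos.2 ⟨1, h1⟩).ne'
  rwa [hsum, inv_mul_cancel_left₀ hcard] at h

/-! ### Non-vacuity: doped torus-limit ground states of the chain exist -/

/-- **Doped torus-limit ground states of the chain exist at every density `p/q ≤ 2`** (so the class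
quantified over above is not empty): with `m_j = 2(j+1)` (rings of length `2q(j+1)` carrying
`2p(j+1)` electrons) there are unit sector ground states at every `j` (`exists_unit_isGroundStateInSector_ring`),
a subsequence `φ`, and an infinite-volume state `ω` on `ℤ` which is their torus limit; it is translation
invariant and even (weak-⋆ compactness, `InfVolFermionState.exists_isTorusLimitOf_subseq_of_isNParticle`).
[cite: BratteliRobinsonII1997, §6.2.4] -/
theorem exists_isTorusLimitOf_sectorGroundState_chain_filling (t U : ℝ) {p q : ℕ} (hq : 1 ≤ q)
    (hp : p ≤ 2 * q) :
    ∃ (ψ : ∀ L, Fock (Orb (FermionTorus 1 L))) (φ : ℕ → ℕ) (ω : InfVolFermionState 1),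
      StrictMono φ ∧
      (∀ j, IsGroundStateInSector (hubbardTorus 1 (q * (2 * (φ j + 1))) t U) (2 * (p * (φ j + 1))) 0
        (ψ (q * (2 * (φ j + 1))))) ∧
      (∀ j, star (ψ (q * (2 * (φ j + 1)))) ⬝ᵥ ψ (q * (2 * (φ j + 1))) = 1) ∧
      ω.IsTorusLimitOf ψ (fun j => q * (2 * (φ j + 1))) ∧ ω.IsTranslationInvariant ∧ ω.IsEven := by
  classical
  -- a unit ground state of the sector `(2·(pL/(2q)), 0)` on every ring; at `L = 2q(k+1)` it is `(2p(k+1), 0)`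
  have hnL : ∀ L : ℕ, p * L / (2 * q) ≤ L := fun L =>
    calc p * L / (2 * q) ≤ 2 * q * L / (2 * q) := Nat.div_le_div_right (Nat.mul_le_mul_right L hp)
      _ = L := Nat.mul_div_cancel_left L (by omega)
  choose ψ hψ1 hψ using fun L => exists_unit_isGroundStateInSector_ring t U L (p * L / (2 * q)) (hnL L)
  have hN : ∀ L, IsNParticle (2 * (p * L / (2 * q))) (ψ L) := fun L => (hψ L).isNParticle'
  have hLs : Tendsto (fun k : ℕ => q * (2 * (k + 1))) atTop atTop := by
    refine tendsto_atTop_mono (fun k => ?_) tendsto_id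
    calc (k : ℕ) ≤ 2 * (k + 1) := by omega
      _ = 1 * (2 * (k + 1)) := (one_mul _).symm
      _ ≤ q * (2 * (k + 1)) := Nat.mul_le_mul_right _ hq
  obtain ⟨φ, hφ, ω, hω, hTI, hev⟩ :=
    InfVolFermionState.exists_isTorusLimitOf_subseq_of_isNParticle ψ hN hLs fun j => hψ1 _
  have hdiv : ∀ k : ℕ, p * (q * (2 * (k + 1))) / (2 * q) = p * (k + 1) := fun k => by
    rw [show p * (q * (2 * (k + 1))) = 2 * q * (p * (k + 1)) by ring, Nat.mul_div_cancel_left _ (by omega)]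
  refine ⟨ψ, φ, ω, hφ, fun j => ?_, fun j => hψ1 _, hω, hTI, hev⟩
  have h := hψ (q * (2 * (φ j + 1)))
  rwa [hdiv] at h

end ChainLimit

end Literature.MathematicalPhysics.QuantumLattice

end
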